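import Summits.BirchSwinnertonDyer.BirchSwinnertonDyer.Theorems.QuadraticBranchSignedControlPlusEtaNonsurjThetaFunctionalEquationNormCoordinateRankBound
import HarnessLib

/-!
# Route `QuadraticBranchSignedControl` (rung K8, cell `bsd-potss`), residual crux `PlusEtaMainConjectureNonsurj`
# (stmt-BirchSwinnertonDyer-19606): THE FUNCTIONAL EQUATION ON THE QUADRATIC BRANCH, XL — THE ORDER CERTIFICATE: **`ord_T Char X⁺(V/K_∞)^η
# ≤ ord_T L_p⁺(V, η, X)` on ANY row** (Kobayashi 4.1η with slack), read from COEFFICIENTS — `coeff_r Lη ≠ 0 ⟹ ord_T Char ≤ r`; at `r = 0`,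
# through Kobayashi's (3.6), **ONE nonzero twisted modular-symbol sum `Σ_{a mod p} η(a)[a/p]^δ_f ≠ 0` ⟹ the `η`-characteristic series does NOT
# vanish at `T = 0`** (seat `bsd-potss-k8eta-c2` g31; kernel; CONDITIONAL on Kobayashi 2.2η / 4.1η in hypothesis position)

WHY. Part XXXVIII §113 gave the `r₀`-part of (C1⁺_η) on any row (`ord_T Char X^η = rank W = ord_T Lη`) from the `η`-rank bound and the
certificate `ord_T Lη = rank W`. THIS FILE supplies the CERTIFICATE SIDE in the currency the census instruments produce (coefficients of `Lη`,
twisted modular-symbol sums) and isolates the half that needs no rank bound and no `V`-certificate at all: Kobayashi's Thm. 4.1η `pⁿ`-clause alone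
gives `g ∣ pⁿLη`, hence **`ord_T g ≤ ord_T Lη ≤ r` whenever `coeff_r Lη ≠ 0`** (§117–§118), and at `r = 0` Kobayashi's (3.6)
(`Lη(0) = −u·ϖ·Σ_{a mod p} ψ(a)[a/p]^δ_f`, tree `IsQuadraticBranchPlusLFunction.constantCoeff`) turns the NUMERICAL non-vanishing of the symbol
sum (the `L(W, 1) ≠ 0` of the additive partner, computed in the cell's censuses for every `ε_W = +1` row) into **`g(0) ≠ 0` for every generator of
`Char X^η`** on ANY row, onto or not (§119) — the rank-zero `r₀`-part of the crux's rows with no surjectivity, no Kim, no (A).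

WHAT (5 theorems). §117 `order_toNat_le_of_coeff_ne_zero`, `order_toNat_eq_of_coeff`; §118 **`order_etaCharGenerator_le_of_namedFacts_of_coeff_ne_zero`**
(any row: `coeff_r Lη ≠ 0 ⟹ ord_T g ≤ r`); §119 **`constantCoeff_ne_zero_of_symbolSum_ne_zero`** ((3.6): symbol sum `≠ 0`, `ϖ ≠ 0` ⟹ `Lη(0) ≠ 0`),
**`constantCoeff_etaCharGenerator_ne_zero_of_namedFacts_of_symbolSum_ne_zero`** (⟹ `g(0) ≠ 0`, `ord_T g = 0`).

HONEST FRAMING (cell `bsd-potss`; FULL-BSD rank ≤ 1 programme, HUMAN RULING D-0036/D-0074): TOOL THEOREMS ONLY, CONDITIONAL on Kobayashi 2003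
Thm. 2.2η / 4.1η (named facts, hypothesis position) and on per-row numerical inputs (a coefficient / a symbol sum `≠ 0`, supplied here for NO row);
nothing about (A), (C1⁺_η), C-cc-1 or `BSD(W,p)` is claimed; no stub of 19606 is proved; crux and route OPEN; nothing booked.
`--supports stmt-BirchSwinnertonDyer-19606`.

References: [Kobayashi2003] Thm. 2.2 (p. 5), (3.6) (p. 7), Thm. 4.1 (p. 8); [MazurTateTeitelbaum1986Invent] §I.8 (8.6); [GreenbergLNM1716] §3.
Tree: Parts XXXII (`order_toNat_le_of_dvd`), XXXVIII (`order_natCast_pow_mul`); `QuadraticBranchSignedMainConjecture.lean`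
(`IsQuadraticBranchPlusLFunction.constantCoeff`).
-/

set_option autoImplicit false
set_option linter.dupNamespace false
noncomputable section

open scoped Classical

open CongruenceSubgroup Field WeierstrassCurve
open Literature.NumberTheory.EllipticCurves
open Literature.NumberTheory.EllipticCurves.ModularForms
open Literature.NumberTheory.GaloisRepresentations
open Literature.NumberTheory.EllipticCurves.IwasawaAlgebra
open Summit.BirchSwinnertonDyer.Rank1Residual.Additive

namespace Summit.BirchSwinnertonDyer.BirchSwinnertonDyer.Theorems.EtaThetaFunctionalEquation

/-! ## §117 Orders from coefficients -/

section Algebra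

variable {p : ℕ} [hp : Fact p.Prime]

/-- `coeff_r L ≠ 0 ⟹ ord_T L ≤ r` (as natural numbers). [folklore] -/
theorem order_toNat_le_of_coeff_ne_zero {L : IwasawaAlgebra p} {r : ℕ} (h : PowerSeries.coeff r L ≠ 0) : (PowerSeries.order L).toNat ≤ r := by
  have h1 : PowerSeries.order L ≤ (r : ℕ) := PowerSeries.order_le r h
  simpa using ENat.toNat_le_toNat h1 (ENat.coe_ne_top r)

/-- `coeff_j L = 0 (j < r)` and `coeff_r L ≠ 0` ⟹ `ord_T L = r`. [folklore] -/
theorem order_toNat_eq_of_coeff {L : IwasawaAlgebra p} {r : ℕ} (hlow : ∀ j < r, PowerSeries.coeff j L = 0) (h : PowerSeries.coeff r L ≠ 0) :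
    (PowerSeries.order L).toNat = r := by
  have h1 : PowerSeries.order L = (r : ℕ) := PowerSeries.order_eq_nat.mpr ⟨h, hlow⟩
  rw [h1]; rfl

end Algebra

/-! ## §118 `ord_T Char X^η ≤ r` from `coeff_r Lη ≠ 0`, any row -/

section Pair

variable {V : WeierstrassCurve ℚ} [V.IsElliptic] [V.IsGloballyMinimal] {p : ℕ} [hp : Fact p.Prime]

/-- **`ord_T Char X^η ≤ ord_T Lη ≤ r` ON ANY ROW** (tower onto or not): GRANTED Kobayashi's Thm. 2.2η and Thm. 4.1η (`pⁿ`-clause) (NAMED facts,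
hypothesis position), for every branch function `Lη = L_p⁺(V, η, X)` with **`coeff_r Lη ≠ 0`** and every generator `g` of the `η`-characteristic
ideal: `ord_T g ≤ ord_T Lη ≤ r` (`g ∣ pⁿLη`, `ord_T(pⁿLη) = ord_T Lη`). No rank bound, no `V`-certificate. CONDITIONAL.
[cite: Kobayashi2003, Thm. 2.2 (p. 5), Thm. 4.1 (p. 8)] -/
theorem order_etaCharGenerator_le_of_namedFacts_of_coeff_ne_zero
    (h22 : Kobayashi2003.thm22_etaSignedSelmerDual_finite_torsion)
    (h41 : Kobayashi2003.thm41_plusEtaCharIdeal_dvd)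
    (hp5 : 5 ≤ p) (hgood : V.HasGoodReductionAtPrime p) (hap : V.frobeniusTrace p = 0)
    {N : ℕ} [NeZero N] {f : CuspForm (Gamma0 N) 2} (hf : IsNewformOf V f) (ϖ : ℚ)
    (hϖ : if Even (p / 2) then (ϖ : ℝ) * V.realPeriodRat = plusPeriod f
      else (ϖ : ℝ) * V.imaginaryPeriodRat = minusPeriod f)
    (Lη : IwasawaAlgebra p) (hL : IsQuadraticBranchPlusLFunction f p ϖ Lη) {r : ℕ} (hcoef : PowerSeries.coeff r Lη ≠ 0)
    (K₀ : Type) [Field K₀] [NumberField K₀] [IsCyclotomicExtension {p} ℚ K₀]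
    [(galRange (K := ℚ) K₀).Normal] (ηq : absoluteGaloisGroup ℚ →* ℤˣ)
    (hηK : ∀ σ ∈ galRange (K := ℚ) K₀, ηq σ = 1) (hη1 : ηq ≠ 1)
    (κ : ZpExtension ℚ p) (γ : absoluteGaloisGroup ℚ) (hκ : κ.IsCyclotomic) (hγ : κ.IsTopGenerator γ)
    (hγK : γ ∈ galRange (K := ℚ) K₀) (hγc : IsCyclotomicVariable p γ)
    (D : EtaSignedSelmerDualData V κ K₀ ℚ_[p] ηq γ 1) {g : IwasawaAlgebra p}
    (hg : D.charIdeal = Ideal.span {g}) :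
    (PowerSeries.order g).toNat ≤ (PowerSeries.order Lη).toNat ∧ (PowerSeries.order Lη).toNat ≤ r := by
  have hp2 : p ≠ 2 := by omega
  obtain ⟨hfin, htor⟩ :=
    EtaSignedSelmerDualData.finite_isTorsion_of_thm22 h22 hηK hp2 hgood hap hκ hγ hγK D
  obtain ⟨⟨n, hn⟩, -⟩ := h41 p K₀ ηq hηK hη1 V hp2 hgood hap hf ϖ hϖ Lη hL κ γ hκ hγ hγK hγc D.toLiterature hfin htor
  rw [EtaSignedSelmerDualData.charIdeal_toLiterature, hg, Ideal.mem_span_singleton] at hn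
  have hL0 : Lη ≠ 0 := fun h ↦ hcoef (by rw [h, map_zero])
  have hpL0 : (p : IwasawaAlgebra p) ^ n * Lη ≠ 0 := by
    rw [natCast_pow_eq_C_pow]
    exact mul_ne_zero (Summit.BirchSwinnertonDyer.Rank1Residual.X1.MuLambda.C_pow_ne_zero n) hL0
  have h1 := order_toNat_le_of_dvd hpL0 hn
  rw [order_natCast_pow_mul] at h1
  exact ⟨h1, order_toNat_le_of_coeff_ne_zero hcoef⟩

/-! ## §119 `r = 0`: one nonzero twisted modular-symbol sum ⟹ `g(0) ≠ 0` -/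

omit [V.IsGloballyMinimal] in
/-- **(3.6) AS A NON-VANISHING CERTIFICATE**: for a branch function `Lη = L_p⁺(V, η, X)` (any period ratio `ϖ ≠ 0`) and a quadratic Dirichlet
character `ψ` mod `p` with **`Σ_{a mod p} ψ(a)[a/p]^δ_f ≠ 0`** (the plus symbol for `p ≡ 1 (4)`, the minus symbol for `p ≡ 3 (4)`): **`Lη(0) ≠ 0`**
(`Lη(0) = −u·ϖ·Σ ψ(a)[a/p]^δ_f`, `u ∈ ℤ_pˣ`; `ℤ_p → ℚ_p → ℂ_p` injective). [cite: Kobayashi2003, (3.6) (p. 7)] [cite: MazurTateTeitelbaum1986Invent, §I.8 (8.6)] -/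
theorem constantCoeff_ne_zero_of_symbolSum_ne_zero {N : ℕ} [NeZero N] {f : CuspForm (Gamma0 N) 2} {ϖ : ℚ} (hϖ0 : ϖ ≠ 0)
    {Lη : IwasawaAlgebra p} (hL : IsQuadraticBranchPlusLFunction f p ϖ Lη)
    (ψ : DirichletCharacter ℂ_[p] (p ^ (0 + 1))) (hψ : orderOf ψ = 2)
    (hsum : (if Even (p / 2) then ratTwistedSymbolSum f ψ else ratMinusTwistedSymbolSum f ψ) ≠ 0) :
    PowerSeries.constantCoeff Lη ≠ 0 := by
  obtain ⟨u, hu⟩ := hL.constantCoeff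
  have h := hu ψ hψ
  intro h0
  rw [h0, map_zero, eq_comm, neg_eq_zero, mul_eq_zero] at h
  rcases h with h1 | h2
  · rw [map_eq_zero_iff _ (algebraMap ℚ_[p] ℂ_[p]).injective, mul_eq_zero] at h1
    rcases h1 with h3 | h4
    · exact (Units.ne_zero u) (PadicInt.coe_eq_zero.mp h3)
    · exact hϖ0 (by exact_mod_cast h4)
  · exact hsum h2

/-- **RANK-ZERO `r₀`-PART ON ANY ROW FROM ONE SYMBOL SUM.** GRANTED Kobayashi's Thm. 2.2η and Thm. 4.1η (`pⁿ`-clause) (NAMED facts), on a good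
`a_p = 0` pair with `p ≥ 5` — tower onto OR NOT —, a branch function `Lη` with period ratio `ϖ ≠ 0`, and a quadratic `ψ` mod `p` with
**`Σ_{a mod p} ψ(a)[a/p]^δ_f ≠ 0`**: every generator `g` of `Char X⁺(V/K_∞)^η` (any `η`-datum) has **`g(0) ≠ 0`, `ord_T g = 0`** — the
`η`-characteristic series does not vanish at the trivial character. CONDITIONAL on the two named facts and the numerical input; claims no (C1⁺_η).
[cite: Kobayashi2003, Thm. 2.2 (p. 5), (3.6) (p. 7), Thm. 4.1 (p. 8)] -/
theorem constantCoeff_etaCharGenerator_ne_zero_of_namedFacts_of_symbolSum_ne_zero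
    (h22 : Kobayashi2003.thm22_etaSignedSelmerDual_finite_torsion)
    (h41 : Kobayashi2003.thm41_plusEtaCharIdeal_dvd)
    (hp5 : 5 ≤ p) (hgood : V.HasGoodReductionAtPrime p) (hap : V.frobeniusTrace p = 0)
    {N : ℕ} [NeZero N] {f : CuspForm (Gamma0 N) 2} (hf : IsNewformOf V f) {ϖ : ℚ} (hϖ0 : ϖ ≠ 0)
    (hϖ : if Even (p / 2) then (ϖ : ℝ) * V.realPeriodRat = plusPeriod f
      else (ϖ : ℝ) * V.imaginaryPeriodRat = minusPeriod f)
    (Lη : IwasawaAlgebra p) (hL : IsQuadraticBranchPlusLFunction f p ϖ Lη)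
    (ψ : DirichletCharacter ℂ_[p] (p ^ (0 + 1))) (hψ : orderOf ψ = 2)
    (hsum : (if Even (p / 2) then ratTwistedSymbolSum f ψ else ratMinusTwistedSymbolSum f ψ) ≠ 0)
    (K₀ : Type) [Field K₀] [NumberField K₀] [IsCyclotomicExtension {p} ℚ K₀]
    [(galRange (K := ℚ) K₀).Normal] (ηq : absoluteGaloisGroup ℚ →* ℤˣ)
    (hηK : ∀ σ ∈ galRange (K := ℚ) K₀, ηq σ = 1) (hη1 : ηq ≠ 1)
    (κ : ZpExtension ℚ p) (γ : absoluteGaloisGroup ℚ) (hκ : κ.IsCyclotomic) (hγ : κ.IsTopGenerator γ)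
    (hγK : γ ∈ galRange (K := ℚ) K₀) (hγc : IsCyclotomicVariable p γ)
    (D : EtaSignedSelmerDualData V κ K₀ ℚ_[p] ηq γ 1) {g : IwasawaAlgebra p}
    (hg : D.charIdeal = Ideal.span {g}) :
    PowerSeries.constantCoeff g ≠ 0 ∧ (PowerSeries.order g).toNat = 0 := by
  have hc0 : PowerSeries.coeff 0 Lη ≠ 0 := by
    rw [PowerSeries.coeff_zero_eq_constantCoeff]
    exact constantCoeff_ne_zero_of_symbolSum_ne_zero hϖ0 hL ψ hψ hsum
  obtain ⟨h1, h2⟩ := order_etaCharGenerator_le_of_namedFacts_of_coeff_ne_zero h22 h41 hp5 hgood hap hf ϖ hϖ Lη hL hc0 K₀ ηq hηK hη1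
    κ γ hκ hγ hγK hγc D hg
  have hord : (PowerSeries.order g).toNat = 0 := by omega
  refine ⟨?_, hord⟩
  -- `g ≠ 0` (it divides... no: from `g ∣ pⁿLη ≠ 0`); then `coeff_{ord g} g ≠ 0` with `ord g = 0`
  have hp2 : p ≠ 2 := by omega
  obtain ⟨hfin, htor⟩ :=
    EtaSignedSelmerDualData.finite_isTorsion_of_thm22 h22 hηK hp2 hgood hap hκ hγ hγK D
  obtain ⟨⟨n, hn⟩, -⟩ := h41 p K₀ ηq hηK hη1 V hp2 hgood hap hf ϖ hϖ Lη hL κ γ hκ hγ hγK hγc D.toLiterature hfin htor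
  rw [EtaSignedSelmerDualData.charIdeal_toLiterature, hg, Ideal.mem_span_singleton] at hn
  have hL0 : Lη ≠ 0 := fun h ↦ hc0 (by rw [h, map_zero])
  have hpL0 : (p : IwasawaAlgebra p) ^ n * Lη ≠ 0 := by
    rw [natCast_pow_eq_C_pow]
    exact mul_ne_zero (Summit.BirchSwinnertonDyer.Rank1Residual.X1.MuLambda.C_pow_ne_zero n) hL0
  have hg0 : g ≠ 0 := by
    rintro rfl
    obtain ⟨q, hq⟩ := hn
    exact hpL0 (by rw [hq, zero_mul])
  have hc := PowerSeries.coeff_order hg0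
  rw [hord, PowerSeries.coeff_zero_eq_constantCoeff] at hc
  exact hc

end Pair

end Summit.BirchSwinnertonDyer.BirchSwinnertonDyer.Theorems.EtaThetaFunctionalEquation

end
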